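import Summits.AtomisticToContinuum.HydrodynamicLimit.Theorems.MourreKoopmanChargesLinearToEntropyInBandVisCoreNToolkit
import Literature.Analysis.FunctionSpaces.TorusCalculusProofs
import HarnessLib

/-!
# Route `MourreKoopmanCharges`, crux `LinearToEntropyInBand` (stmt-AtomisticToContinuum-17740), skeleton v8:
# stub 4a-ii, missing lemma M3 — collisional identification of the visible functional (the frozen pair kernel)

Support file (`--supports stmt-AtomisticToContinuum-17740`; registered helper `stub_windowClauseCollisionalId`; worker of
lead prover-line-…-17740-c5-0, wave 4; plan `work/stubs/WINDOWCLAUSE-PLAN.md` § 1 (2), § 3 M3).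

At the entropy-variable test fields `A_j = ∇(u_j/θ)`, `A₄ = ∇(−θ⁻¹)` the collision term `visCollTermN` (toolkit A) of the
first partner `p` of an ordered contact pair `(p, q)` — `(ε/2) ∫₀¹ [Σ_j ⟪A_j(x_p − rεω), ω⟫ Δv_j + ⟪A₄(x_p − rεω), ω⟫ Δe] dr`,
`ω = Δv/‖Δv‖` — IS the frozen pair kernel `½{Σ_k [(u_k/θ)(x_p) − (u_k/θ)(x_q)] Δv_k − [θ⁻¹(x_p) − θ⁻¹(x_q)] Δe}` of the
record `(p, q)` (the kernel of `ClampedCurrentsDockPathwise.pairKernel` / C0 `stub_windowBalance` with profiles frozen),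
when `p` is visible before and after, else `0` (`visCollTermN_eq_frozenPairKernel`, § 3).  Mechanism: the momentum
transfer to `p` is `Δv = c (x_p − x_q)_min` with `c ≥ 0` for a post-collisional (non-incoming) configuration, so
`ω = ε⁻¹ (x_p − x_q)_min` and the contact segment `r ↦ x_p + proj(−rεω)` runs from `x_p` to `x_q` ON THE TORUS; the
fundamental theorem of calculus along it (`integral_inner_gradient_segment`, § 1) turns `ε ∫₀¹ ⟪∇φ, ω⟫` into
`φ(x_p) − φ(x_q)`.

STATEMENT NOTE (worker, plan → landed).  The plan's M3 quantified over every `y ∈ contactSet p q`; for an INCOMING `y`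
(`c < 0`) the segment ends at `x_p + (x_p − x_q)_min ≠ x_q` and the identity is false.  The landed statement adds
`¬ IsIncoming G y p q` — automatic along the flow, where `Φ_r z` at a collision time is post-collisional
(`IsHardSphereTrajectory.isOutgoing_of_mem_contactSet`) — and drops the unused `ε_N < 1/2`.  § 4 lifts it to the
flow: the collision piece of `visCoreN` at these fields is the collision pair sum of the visibility-weighted frozen
kernel, and the DROPPED COLLISIONS functional `collisionSum K − Σᶠ visCollN` is the pair sum of `(1 − 𝟙{vis⁻ ∧ vis⁺}) K`
(the shape `dropped_kernel_le_ict_integrand` of `…WindowClausePieces` prices).  Nothing here restates the crux, a stub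
or the Statement.  References: H.-T. Yau, Lett. Math. Phys. 22 (1991) § 2; H. Spohn, *Large Scale Dynamics of
Interacting Particles* (1991), Part I § 3.2–3.3; C. Cercignani, R. Illner, M. Pulvirenti (1994) App. 4.A.
-/

noncomputable section

open MeasureTheory Filter Set
open scoped ENNReal Topology InnerProductSpace BigOperators

namespace Summit.AtomisticToContinuum.HydrodynamicLimit.Theorems.LTEInBand

open Literature.MathematicalPhysics.KineticTheory Literature.Analysis.FluidPDE Literature.Analysis.FunctionSpaces

/-! ## § 1 The fundamental theorem of calculus along a torus segment -/

/-- **FTC along a straight segment of the torus**: for a smooth `f : 𝕋³ → ℝ`, a base point `x` and a vector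
`V ∈ ℝ³`, `∫₀¹ ⟪∇f(x + proj(rV)), V⟫ dr = f(x + proj V) − f(x)` (`Torus.hasDerivAt_comp_add_proj_smul`,
`Torus.inner_gradient_left`, `intervalIntegral.integral_eq_sub_of_hasDerivAt`). -/
theorem integral_inner_gradient_segment {f : T3 → ℝ} (hf : Torus.IsSmooth f) (x : T3) (V : V3) :
    ∫ r in (0 : ℝ)..1, ⟪Torus.gradient f (x + Torus.proj (r • V)), V⟫_ℝ = f (x + Torus.proj V) - f x := by
  have hf1 : Torus.IsContDiff 1 f := hf.isContDiff (by simp)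
  have hderiv : ∀ r : ℝ, HasDerivAt (fun s : ℝ => f (x + Torus.proj (s • V)))
      ⟪Torus.gradient f (x + Torus.proj (r • V)), V⟫_ℝ r := fun r => by
    have h := Torus.hasDerivAt_comp_add_proj_smul hf1 x V r
    rwa [Torus.lineDeriv_eq_fderiv_apply hf1, ← Torus.inner_gradient_left] at h
  have hcont : Continuous fun r : ℝ => ⟪Torus.gradient f (x + Torus.proj (r • V)), V⟫_ℝ :=
    (hf.gradient.continuous.comp
      (continuous_const.add (Torus.continuous_proj.comp (continuous_id.smul continuous_const)))).inner
      continuous_const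
  have h := intervalIntegral.integral_eq_sub_of_hasDerivAt (fun r _ => hderiv r) (hcont.intervalIntegrable 0 1)
  simpa only [one_smul, zero_smul, Torus.proj_zero, add_zero] using h

/-- **The contact-segment integral of `visCollTermN` for a gradient field**: with `ω = ε⁻¹ n`, `0 < ε`, the segment
`r ↦ x + proj(−rεω)` runs from `x` to `x + proj(−n)` and `∫₀¹ ⟪∇f(x + proj(−rεω)), ω⟫ dr = ε⁻¹ (f(x) − f(x + proj(−n)))`. -/
theorem integral_inner_gradient_contactSegment {f : T3 → ℝ} (hf : Torus.IsSmooth f) (x : T3) (n : V3) {ε : ℝ}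
    (hε : ε ≠ 0) :
    ∫ r in (0 : ℝ)..1, ⟪Torus.gradient f (x + Torus.proj (-(r * ε) • (ε⁻¹ • n))), ε⁻¹ • n⟫_ℝ =
      ε⁻¹ * (f x - f (x + Torus.proj (-n))) := by
  have hseg : ∀ r : ℝ, -(r * ε) • (ε⁻¹ • n) = r • (-n) := fun r => by
    rw [smul_smul, smul_neg, ← neg_smul, neg_mul, mul_assoc, mul_inv_cancel₀ hε, mul_one]
  simp_rw [hseg, real_inner_smul_right]
  rw [intervalIntegral.integral_const_mul]
  have h := integral_inner_gradient_segment hf x (-n)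
  simp_rw [inner_neg_right] at h
  rw [intervalIntegral.integral_neg] at h
  rw [show (∫ r in (0 : ℝ)..1, ⟪Torus.gradient f (x + Torus.proj (r • -n)), n⟫_ℝ) = f x - f (x + Torus.proj (-n)) by
    linarith]

/-! ## § 2 Contact geometry of an ordered pair on the torus -/

section Contact

variable {N : ℕ}

/-- **The momentum transfer to the first partner is along the line of centres**: undoing the elastic jump of `(p, q)`,
`v_p⁺ − v_p⁻ = c · n`, `n = (x_p − x_q)_min`, `c = ⟪v_p⁺ − v_q⁺, n⟫ / ‖n‖²`. -/
theorem vel_sub_collidePair_vel_eq_smul {p q : Fin (N + 1)} (hpq : p ≠ q) (y : Config (N + 1) (Fin 3) T3) :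
    (y p).2 - (collidePair (Torus.geometry (Fin 3)) p q y p).2 =
      (⟪(y p).2 - (y q).2, (Torus.geometry (Fin 3)).sepVec (y p).1 (y q).1⟫_ℝ /
          ‖(Torus.geometry (Fin 3)).sepVec (y p).1 (y q).1‖ ^ 2) • (Torus.geometry (Fin 3)).sepVec (y p).1 (y q).1 := by
  rw [collidePair_apply_left hpq]
  simp only [reflectVel, sub_sub_cancel]

/-- **The minimal-image separation vector leads back to the partner ON THE TORUS**: `x_p + proj(−(x_p − x_q)_min) = x_q`
(`proj ∘ reprSym = id`). -/
theorem pos_add_proj_neg_sepVec (x x' : T3) :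
    x + Torus.proj (-(Torus.geometry (Fin 3)).sepVec x x') = x' := by
  rw [Torus.geometry_sepVec, Torus.proj_neg, Literature.Analysis.FluidPDE.Torus.proj_reprSym]
  abel

/-- For a NON-INCOMING configuration the transfer coefficient `c = ⟪v_p − v_q, n⟫/‖n‖²` is nonnegative. -/
theorem transferCoeff_nonneg_of_not_isIncoming {p q : Fin (N + 1)} {y : Config (N + 1) (Fin 3) T3}
    (hout : ¬ IsIncoming (Torus.geometry (Fin 3)) y p q) :
    0 ≤ ⟪(y p).2 - (y q).2, (Torus.geometry (Fin 3)).sepVec (y p).1 (y q).1⟫_ℝ /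
      ‖(Torus.geometry (Fin 3)).sepVec (y p).1 (y q).1‖ ^ 2 := by
  refine div_nonneg ?_ (sq_nonneg _)
  rw [real_inner_comm]
  exact not_lt.1 hout

end Contact

/-! ## § 3 M3: the collision term at the entropy-variable fields is the frozen pair kernel -/

section M3

variable {σ : ℝ} {N : ℕ}

/-- **(M3) Collisional identification of the visible functional** (FTC along the minimal-image contact segment on `𝕋³`;
`ω = Δv/‖Δv‖` is the contact normal `ε⁻¹ (x_p − x_q)_min` for a non-incoming configuration, and
`x_p + proj(−ε ω) = x_q`): at the test fields `A_j = ∇(u_j/θ)`, `A₄ = ∇(−θ⁻¹)` the collision term of particle `p` at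
the elastic collision of the ordered contact pair `(p, q)` of a NON-INCOMING configuration `y` (post-collisional, as
`Φ_r z` at every collision time) IS the frozen pair kernel of the record `(p, q)` —
`((φ(x_p) − φ(x_q))·Δv_p − (θ⁻¹(x_p) − θ⁻¹(x_q)) Δe_p)/2` — when `p` is visible before and after, else `0`.
Degenerate transfers (`Δv_p = 0`: grazing, or `ε ≤ 0`) make both sides vanish. -/
theorem visCollTermN_eq_frozenPairKernel {ρs θ : T3 → ℝ} {us u : T3 → V3} (hθ : Torus.IsSmooth θ)
    (hu : Torus.IsSmooth u) (hθ0 : ∀ x, 0 < θ x) (R K : ℝ)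
    (y : Config (N + 1) (Fin 3) T3) {p q : Fin (N + 1)} (hpq : p ≠ q)
    (hc : y ∈ contactSet (Torus.geometry (Fin 3)) (N + 1) (hsDiameter σ N) p q)
    (hout : ¬ IsIncoming (Torus.geometry (Fin 3)) y p q) :
    visCollTermN σ ρs us (Torus.gradient fun x => -(θ x)⁻¹) (fun j => Torus.gradient fun x => u x j / θ x) R K N
        (collidePair (Torus.geometry (Fin 3)) p q y) y p =
      (if VisibleN ρs us R K N (collidePair (Torus.geometry (Fin 3)) p q y) p ∧ VisibleN ρs us R K N y p then
        ((∑ k : Fin 3, (u (y p).1 k / θ (y p).1 - u (y q).1 k / θ (y q).1) *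
            ((y p).2 k - ((collidePair (Torus.geometry (Fin 3)) p q y) p).2 k)) -
          ((θ (y p).1)⁻¹ - (θ (y q).1)⁻¹) *
            ((‖(y p).2‖ ^ 2 - ‖((collidePair (Torus.geometry (Fin 3)) p q y) p).2‖ ^ 2) / 2)) / 2
      else 0) := by
  -- smoothness of the test functions
  have hφs : ∀ j : Fin 3, Torus.IsSmooth fun x => u x j / θ x := fun j =>
    ContDiff.div (hu.apply j) hθ fun _ => (hθ0 _).ne'
  have hψs : Torus.IsSmooth fun x => -(θ x)⁻¹ := ContDiff.neg (ContDiff.inv hθ fun _ => (hθ0 _).ne')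
  unfold visCollTermN
  dsimp only
  -- contact geometry
  set ε : ℝ := hsDiameter σ N with hεdef
  set n : V3 := (Torus.geometry (Fin 3)).sepVec (y p).1 (y q).1 with hndef
  set c : ℝ := ⟪(y p).2 - (y q).2, n⟫_ℝ / ‖n‖ ^ 2 with hcdef
  have hnε : ‖n‖ = ε := (mem_contactSet.1 hc).2
  have hΔ : (y p).2 - (collidePair (Torus.geometry (Fin 3)) p q y p).2 = c • n :=
    vel_sub_collidePair_vel_eq_smul hpq y
  have hc0 : 0 ≤ c := transferCoeff_nonneg_of_not_isIncoming hout
  have hxq : (y p).1 + Torus.proj (-n) = (y q).1 := pos_add_proj_neg_sepVec (y p).1 (y q).1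
  split_ifs with hvis
  swap
  · rfl
  by_cases hΔ0 : (y p).2 - (collidePair (Torus.geometry (Fin 3)) p q y p).2 = 0
  · -- degenerate transfer: both sides vanish
    have hv : (collidePair (Torus.geometry (Fin 3)) p q y p).2 = (y p).2 := (sub_eq_zero.1 hΔ0).symm
    simp [hv]
  -- honest transfer `Δv = c n`, `c > 0`, `ε = ‖n‖ > 0`, `ω = ε⁻¹ n`
  have hcn : c ≠ 0 ∧ n ≠ 0 := by
    rw [hΔ] at hΔ0
    exact smul_ne_zero_iff.1 hΔ0
  have hεpos : 0 < ε := by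
    rw [← hnε]
    exact norm_pos_iff.2 hcn.2
  have hω : ‖(y p).2 - (collidePair (Torus.geometry (Fin 3)) p q y p).2‖⁻¹ •
      ((y p).2 - (collidePair (Torus.geometry (Fin 3)) p q y p).2) = ε⁻¹ • n := by
    rw [hΔ, norm_smul, Real.norm_of_nonneg hc0, hnε, smul_smul]
    congr 1
    field_simp [hcn.1, hεpos.ne']
  rw [hω]
  -- the contact-segment integrals of the gradient fields
  have hI : ∀ {f : T3 → ℝ}, Torus.IsSmooth f →
      ∫ r in (0 : ℝ)..1, ⟪Torus.gradient f ((y p).1 + Torus.proj (-(r * ε) • (ε⁻¹ • n))), ε⁻¹ • n⟫_ℝ =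
        ε⁻¹ * (f (y p).1 - f (y q).1) := fun hf => by
    rw [integral_inner_gradient_contactSegment hf _ n hεpos.ne', hxq]
  have hC : ∀ {f : T3 → ℝ}, Torus.IsSmooth f →
      Continuous fun r : ℝ => ⟪Torus.gradient f ((y p).1 + Torus.proj (-(r * ε) • (ε⁻¹ • n))), ε⁻¹ • n⟫_ℝ :=
    fun hf => (hf.gradient.continuous.comp (continuous_const.add (Torus.continuous_proj.comp
      ((continuous_id.mul continuous_const).neg.smul continuous_const)))).inner continuous_const
  have i1' : ∀ j : Fin 3, IntervalIntegrable (fun r : ℝ =>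
      ⟪Torus.gradient (fun x => u x j / θ x) ((y p).1 + Torus.proj (-(r * ε) • (ε⁻¹ • n))), ε⁻¹ • n⟫_ℝ *
        ((y p).2 - (collidePair (Torus.geometry (Fin 3)) p q y p).2) j) volume 0 1 := fun j =>
    ((hC (hφs j)).mul continuous_const).intervalIntegrable 0 1
  have i1 : IntervalIntegrable (fun r : ℝ => ∑ j : Fin 3,
      ⟪Torus.gradient (fun x => u x j / θ x) ((y p).1 + Torus.proj (-(r * ε) • (ε⁻¹ • n))), ε⁻¹ • n⟫_ℝ *
        ((y p).2 - (collidePair (Torus.geometry (Fin 3)) p q y p).2) j) volume 0 1 :=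
    (continuous_finsetSum _ fun j _ => (hC (hφs j)).mul continuous_const).intervalIntegrable 0 1
  have i2 : IntervalIntegrable (fun r : ℝ =>
      ⟪Torus.gradient (fun x => -(θ x)⁻¹) ((y p).1 + Torus.proj (-(r * ε) • (ε⁻¹ • n))), ε⁻¹ • n⟫_ℝ *
        (‖(y p).2‖ ^ 2 - ‖(collidePair (Torus.geometry (Fin 3)) p q y p).2‖ ^ 2) / 2) volume 0 1 :=
    (((hC hψs).mul continuous_const).div_const _).intervalIntegrable 0 1
  rw [intervalIntegral.integral_add i1 i2, intervalIntegral.integral_finsetSum fun j _ => i1' j,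
    intervalIntegral.integral_div, intervalIntegral.integral_mul_const, hI hψs]
  simp_rw [intervalIntegral.integral_mul_const, hI (hφs _)]
  simp only [PiLp.sub_apply, Fin.sum_univ_three]
  field_simp
  ring

end M3

/-! ## § 4 Along the flow: the collision piece at the entropy-variable fields and the dropped collisions -/

section Flow

variable {σ : ℝ} {N : ℕ}

/-- **Congruence of collision pair sums along a good orbit**: summands that agree on the ORDERED CONTACT PAIRS of the
(post-collisional, hence non-incoming: `IsHardSphereTrajectory.isOutgoing_of_mem_contactSet`) configurations
`Φ_r z` have the same pair sum. -/
theorem collisionPairSum_congr_of_good (Φ : HardSphereFlow (Torus.geometry (Fin 3)) (hsDiameter σ N) (N + 1))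
    {z : Config (N + 1) (Fin 3) T3} (hz : z ∈ Φ.good) (S : Set ℝ)
    {g g' : ℝ → Config (N + 1) (Fin 3) T3 → Fin (N + 1) → Fin (N + 1) → ℝ}
    (h : ∀ (r : ℝ) (i j : Fin (N + 1)), i ≠ j →
      Φ.flow r z ∈ contactSet (Torus.geometry (Fin 3)) (N + 1) (hsDiameter σ N) i j →
      ¬ IsIncoming (Torus.geometry (Fin 3)) (Φ.flow r z) i j → g r (Φ.flow r z) i j = g' r (Φ.flow r z) i j) :
    Φ.collisionPairSum S g z = Φ.collisionPairSum S g' z := by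
  unfold HardSphereFlow.collisionPairSum Literature.Analysis.FluidPDE.collisionPairSum
  refine finsum_mem_congr rfl fun r _ => Finset.sum_congr rfl fun pr hpr => ?_
  obtain ⟨hne, hc⟩ := mem_contactPairs.1 hpr
  exact h r pr.1 pr.2 hne hc fun hin => lt_asymm hin ((Φ.isTrajectory z hz).isOutgoing_of_mem_contactSet hne hc)

/-- **The collision piece of `visCoreN` at the entropy-variable fields is the pair sum of the visibility-weighted
frozen kernel** (good datum, `ε_N < 1/2`: `finsum_visCollN_eq_collisionPairSum` of toolkit A, then M3 on every
ordered contact pair). -/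
theorem finsum_visCollN_eq_collisionPairSum_frozenKernel {ρs θ : T3 → ℝ} {us u : T3 → V3} (hθ : Torus.IsSmooth θ)
    (hu : Torus.IsSmooth u) (hθ0 : ∀ x, 0 < θ x) (hε : hsDiameter σ N < 2⁻¹) (R K : ℝ)
    (Φ : HardSphereFlow (Torus.geometry (Fin 3)) (hsDiameter σ N) (N + 1)) {z : Config (N + 1) (Fin 3) T3}
    (hz : z ∈ Φ.good) (S : Set ℝ) :
    ∑ᶠ r ∈ collisionTimes (Torus.geometry (Fin 3)) (hsDiameter σ N) (fun r' => Φ.flow r' z) ∩ S,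
        visCollN σ ρs us (Torus.gradient fun x => -(θ x)⁻¹) (fun j => Torus.gradient fun x => u x j / θ x) R K N
          (Function.leftLim (fun r' => Φ.flow r' z) r) (Φ.flow r z) =
      Φ.collisionPairSum S (fun _ y i j =>
        if VisibleN ρs us R K N (collidePair (Torus.geometry (Fin 3)) i j y) i ∧ VisibleN ρs us R K N y i then
          ((∑ k : Fin 3, (u (y i).1 k / θ (y i).1 - u (y j).1 k / θ (y j).1) *
              ((y i).2 k - ((collidePair (Torus.geometry (Fin 3)) i j y) i).2 k)) -
            ((θ (y i).1)⁻¹ - (θ (y j).1)⁻¹) *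
              ((‖(y i).2‖ ^ 2 - ‖((collidePair (Torus.geometry (Fin 3)) i j y) i).2‖ ^ 2) / 2)) / 2
        else 0) z := by
  rw [finsum_visCollN_eq_collisionPairSum ρs us _ _ R K hε Φ hz S]
  exact collisionPairSum_congr_of_good Φ hz S fun r i j hij hc hout =>
    visCollTermN_eq_frozenPairKernel hθ hu hθ0 R K (Φ.flow r z) hij hc hout

/-- **The dropped collisions** (good datum, `ε_N < 1/2`, bounded `S`): the frozen pair kernel `K` summed over ALL
collision records minus the collision piece of `visCoreN` at the entropy-variable fields is the pair sum of
`(1 − 𝟙{fst visible before ∧ after}) · K` — the functional `dropped_kernel_le_ict_integrand` /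
`ict_indicator_of_not_visible_pair` of `…WindowClausePieces` price against `InvisibleCollisionThroughputW`. -/
theorem collisionSum_sub_finsum_visCollN_eq {ρs θ : T3 → ℝ} {us u : T3 → V3} (hθ : Torus.IsSmooth θ)
    (hu : Torus.IsSmooth u) (hθ0 : ∀ x, 0 < θ x) (hε : hsDiameter σ N < 2⁻¹) (R K : ℝ)
    (Φ : HardSphereFlow (Torus.geometry (Fin 3)) (hsDiameter σ N) (N + 1)) {z : Config (N + 1) (Fin 3) T3}
    (hz : z ∈ Φ.good) {S : Set ℝ} {t₁ t₂ : ℝ} (hS : S ⊆ Set.Icc t₁ t₂) :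
    Φ.collisionSum S (fun c =>
        ((∑ k : Fin 3, (u c.fstPos k / θ c.fstPos - u c.sndPos k / θ c.sndPos) * (c.postVel.1 k - c.preVel.1 k)) -
          ((θ c.fstPos)⁻¹ - (θ c.sndPos)⁻¹) * ((‖c.postVel.1‖ ^ 2 - ‖c.preVel.1‖ ^ 2) / 2)) / 2) z -
      ∑ᶠ r ∈ collisionTimes (Torus.geometry (Fin 3)) (hsDiameter σ N) (fun r' => Φ.flow r' z) ∩ S,
        visCollN σ ρs us (Torus.gradient fun x => -(θ x)⁻¹) (fun j => Torus.gradient fun x => u x j / θ x) R K N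
          (Function.leftLim (fun r' => Φ.flow r' z) r) (Φ.flow r z) =
      Φ.collisionPairSum S (fun _ y i j =>
        (1 - if VisibleN ρs us R K N (collidePair (Torus.geometry (Fin 3)) i j y) i ∧ VisibleN ρs us R K N y i
          then (1 : ℝ) else 0) *
        (((∑ k : Fin 3, (u (y i).1 k / θ (y i).1 - u (y j).1 k / θ (y j).1) *
              ((y i).2 k - ((collidePair (Torus.geometry (Fin 3)) i j y) i).2 k)) -
            ((θ (y i).1)⁻¹ - (θ (y j).1)⁻¹) *
              ((‖(y i).2‖ ^ 2 - ‖((collidePair (Torus.geometry (Fin 3)) i j y) i).2‖ ^ 2) / 2)) / 2)) z := by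
  have hfin : (collisionTimes (Torus.geometry (Fin 3)) (hsDiameter σ N) (fun r' => Φ.flow r' z) ∩ S).Finite :=
    Φ.finite_collisionTimes_inter hz hS
  rw [finsum_visCollN_eq_collisionPairSum_frozenKernel hθ hu hθ0 hε R K Φ hz S]
  unfold HardSphereFlow.collisionSum Literature.Analysis.FluidPDE.collisionSum HardSphereFlow.collisionPairSum
  rw [collisionPairSum_eq_finset_sum hfin, collisionPairSum_eq_finset_sum hfin, collisionPairSum_eq_finset_sum hfin,
    ← Finset.sum_sub_distrib]
  refine Finset.sum_congr rfl fun r _ => ?_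
  rw [← Finset.sum_sub_distrib]
  refine Finset.sum_congr rfl fun pr hpr => ?_
  obtain ⟨hne, -⟩ := mem_contactPairs.1 hpr
  simp only [HardSphereCollisionRecord.ofConfig_fstPos, HardSphereCollisionRecord.ofConfig_sndPos,
    HardSphereCollisionRecord.ofConfig_postVel, HardSphereCollisionRecord.ofConfig_preVel, collidePair_apply_left hne]
  split_ifs <;> ring

end Flow

/-! ## The registered helper stub -/

/-- **Registered helper stub `stub_windowClauseCollisionalId` (M3 of the plan of stub 4a-ii, skeleton v8, crux
stmt-17740)**: the collisional identification of the visible functional at the entropy-variable test fields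
(`visCollTermN_eq_frozenPairKernel`, with the non-incoming hypothesis the plan's signature was missing) and the dropped
collisions functional along a good orbit (`collisionSum_sub_finsum_visCollN_eq`), restated with fully qualified names. -/
theorem stub_windowClauseCollisionalId : (∀ (σ : ℝ) (N : ℕ) (ρs θ : Literature.MathematicalPhysics.KineticTheory.T3 → ℝ) (us u : Literature.MathematicalPhysics.KineticTheory.T3 → Literature.MathematicalPhysics.KineticTheory.V3), Literature.Analysis.FunctionSpaces.Torus.IsSmooth θ → Literature.Analysis.FunctionSpaces.Torus.IsSmooth u → (∀ x, 0 < θ x) → ∀ (R K : ℝ) (y : Literature.Analysis.FluidPDE.Config (N + 1) (Fin 3) Literature.MathematicalPhysics.KineticTheory.T3) (p q : Fin (N + 1)), p ≠ q → y ∈ Literature.Analysis.FluidPDE.contactSet (Literature.Analysis.FluidPDE.Torus.geometry (Fin 3)) (N + 1) (Literature.MathematicalPhysics.KineticTheory.hsDiameter σ N) p q → ¬ Literature.Analysis.FluidPDE.IsIncoming (Literature.Analysis.FluidPDE.Torus.geometry (Fin 3)) y p q → Summit.AtomisticToContinuum.HydrodynamicLimit.Theorems.LTEInBand.visCollTermN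 σ ρs us (Literature.Analysis.FunctionSpaces.Torus.gradient fun x => -(θ x)⁻¹) (fun j => Literature.Analysis.FunctionSpaces.Torus.gradient fun x => u x j / θ x) R K N (Literature.Analysis.FluidPDE.collidePair (Literature.Analysis.FluidPDE.Torus.geometry (Fin 3)) p q y) y p = (if Summit.AtomisticToContinuum.HydrodynamicLimit.Theorems.LTEInBand.VisibleN ρs us R K N (Literature.Analysis.FluidPDE.collidePair (Literature.Analysis.FluidPDE.Torus.geometry (Fin 3)) p q y) p ∧ Summit.AtomisticToContinuum.HydrodynamicLimit.Theorems.LTEInBand.VisibleN ρs us R K N y p then ((∑ k : Fin 3, (u (y p).1 k / θ (y p).1 - u (y q).1 k / θ (y q).1) * ((y p).2 k - ((Literature.Analysis.FluidPDE.collidePair (Literature.Analysis.FluidPDE.Torus.geometry (Fin 3)) p q y) p).2 k)) - ((θ (y p).1)⁻¹ - (θ (y q).1)⁻¹) * ((‖(y p).2‖ ^ 2 - ‖((Literature.Analysis.FluidPDE.collidePair (Literature.Analysis.FluidPDE.Torus.geometry (Fin 3)) p q y) p).2‖ ^ 2) / 2)) / 2 else 0)) ∧ (∀ (σ : ℝ)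 (N : ℕ) (ρs θ : Literature.MathematicalPhysics.KineticTheory.T3 → ℝ) (us u : Literature.MathematicalPhysics.KineticTheory.T3 → Literature.MathematicalPhysics.KineticTheory.V3), Literature.Analysis.FunctionSpaces.Torus.IsSmooth θ → Literature.Analysis.FunctionSpaces.Torus.IsSmooth u → (∀ x, 0 < θ x) → Literature.MathematicalPhysics.KineticTheory.hsDiameter σ N < 2⁻¹ → ∀ (R K : ℝ) (Φ : Literature.Analysis.FluidPDE.HardSphereFlow (Literature.Analysis.FluidPDE.Torus.geometry (Fin 3)) (Literature.MathematicalPhysics.KineticTheory.hsDiameter σ N) (N + 1)) (z : Literature.Analysis.FluidPDE.Config (N + 1) (Fin 3) Literature.MathematicalPhysics.KineticTheory.T3), z ∈ Φ.good → ∀ (S : Set ℝ) (t₁ t₂ : ℝ), S ⊆ Set.Icc t₁ t₂ → Φ.collisionSum S (fun c => ((∑ k : Fin 3, (u c.fstPos k / θ c.fstPos - u c.sndPos k / θ c.sndPos) * (c.postVel.1 k - c.preVel.1 k)) - ((θ c.fstPos)⁻¹ - (θ c.sndPos)⁻¹) * ((‖c.postVel.1‖ ^ 2 - ‖c.preVel.1‖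 ^ 2) / 2)) / 2) z - (∑ᶠ r ∈ Literature.Analysis.FluidPDE.collisionTimes (Literature.Analysis.FluidPDE.Torus.geometry (Fin 3)) (Literature.MathematicalPhysics.KineticTheory.hsDiameter σ N) (fun r' => Φ.flow r' z) ∩ S, Summit.AtomisticToContinuum.HydrodynamicLimit.Theorems.LTEInBand.visCollN σ ρs us (Literature.Analysis.FunctionSpaces.Torus.gradient fun x => -(θ x)⁻¹) (fun j => Literature.Analysis.FunctionSpaces.Torus.gradient fun x => u x j / θ x) R K N (Function.leftLim (fun r' => Φ.flow r' z) r) (Φ.flow r z)) = Φ.collisionPairSum S (fun _ y i j => (1 - if Summit.AtomisticToContinuum.HydrodynamicLimit.Theorems.LTEInBand.VisibleN ρs us R K N (Literature.Analysis.FluidPDE.collidePair (Literature.Analysis.FluidPDE.Torus.geometry (Fin 3)) i j y) i ∧ Summit.AtomisticToContinuum.HydrodynamicLimit.Theorems.LTEInBand.VisibleN ρs us R K N y i then (1 : ℝ) else 0) * (((∑ k : Fin 3, (u (y i).1 k / θ (y i).1 - u (y j).1 k / θ (y j).1) * ((y i).2 k - ((Literature.Analysis.FluidPDE.collidePair (Literature.Analysis.FluidPDE.Torus.geometry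 (Fin 3)) i j y) i).2 k)) - ((θ (y i).1)⁻¹ - (θ (y j).1)⁻¹) * ((‖(y i).2‖ ^ 2 - ‖((Literature.Analysis.FluidPDE.collidePair (Literature.Analysis.FluidPDE.Torus.geometry (Fin 3)) i j y) i).2‖ ^ 2) / 2)) / 2)) z) :=
  ⟨fun _ _ _ _ _ _ hθ hu hθ0 R K y _ _ hpq hc hout => visCollTermN_eq_frozenPairKernel hθ hu hθ0 R K y hpq hc hout,
    fun _ _ _ _ _ _ hθ hu hθ0 hε R K Φ _ hz _ _ _ hS => collisionSum_sub_finsum_visCollN_eq hθ hu hθ0 hε R K Φ hz hS⟩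

end Summit.AtomisticToContinuum.HydrodynamicLimit.Theorems.LTEInBand

end
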